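import Summits.BirchSwinnertonDyer.BirchSwinnertonDyer.Theorems.KimAtThreeFineKatoDefinedLambdaExpStarDefs
import HarnessLib

/-!
# Kato's value datum DEFINED, VIII — the RATIONALITY clause (C4) `Λ z = 1 ⊗ x` for `Λ := katoLambda` READ WITHOUT `Ψ`:
# «at the one completion `L_{w₀}`, `exp*_{w₀}(loc_{w₀}(g_w · z))` is the `w₀`-adic image of the conjugate `g̃_w x`, for every
# `w ∣ p`» (crux `KatoKuriharaPortThreeShared`, stmt-BirchSwinnertonDyer-19560; cell `bsd-addord`, seat w2-acc5 gen 6; route W2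
# `KimAtThreeKolyvagin`; `--supports 19560`, helper)

HONEST FRAMING.  TOOL theorems (no definition, no named fact, no instance, no `sorry`); every `p`, `k`, `r`; closes nothing;
nothing is booked; BSD is not proved by any of this.

WHAT.  The print-shaped packages over the DEFINED datum (w2-c3 g9 `hKatoPᵘ` for the deep family, w2-acc4 g6 `hKatoPrintPos₀`
for 19560) display Kato's Thm. 9.7 as (C4) «`katoLambda … (z k r) = (1 : ℚ_p) ⊗ₜ x k r`», a statement inside the semi-local
algebra `ℚ_p ⊗ ℚ(ζ_m)` through the isomorphism `Ψ : ℚ_p ⊗ ℚ(ζ_m) ≃ ∏_{w ∣ p} L_w`.  THIS FILE unfolds it into the VALUE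
statement a reader of Kato matches against print (§9.4/Thm. 9.7: `exp*(z_m) ∈ S(f) ⊗ ℚ(ζ_m)`, i.e. placewise rational values):

* `katoLambda_eq_one_tmul_iff` — **`katoLambda … z = 1 ⊗ₜ x ↔ ∀ w ∣ p, exp*_{w₀}(loc^{tower}_{w₀}(H1toInt (g_w · z))) = ι_{w₀}(g̃_w x)`**
  (`expStarTowerMap … (conjMap (g w) 1 z) = algebraMap L L_{w₀} (sigma m (χ_m (g w)) x)`): no `Ψ`, no tensor product — the
  value of the defined scalar dual exponential at ONE completion on the Galois twists of the class, against the `w₀`-adic images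
  of the Galois conjugates of ONE element `x ∈ ℚ(ζ_m)` (`apply_katoLambda`, `hΨ` at `s = 1`, `galAdicCompletionMap_coe_algEquiv`,
  and `(g̃_w⁻¹)_*` invertible);
* `expStarTowerMap_conjMap_eq_of_katoLambda_eq_one_tmul` — the forward reading at `w = w₀`:
  `katoLambda … z = 1 ⊗ₜ x → exp*_{w₀}(loc_{w₀}(g_{w₀} · z)) = ι_{w₀}(g̃_{w₀} x)`.

References: K. Kato, Astérisque 295 (2004) §9.4, Thm. 9.7 (p. 189) [Kato2004Asterisque]; J. W. S. Cassels, A. Fröhlich (1967)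
Ch. II §10 (10.2), Ch. VII §1.1 [CasselsFrohlichANT1967].
-/

noncomputable section

-- the cell's Theorems namespace `Summit.BirchSwinnertonDyer.BirchSwinnertonDyer.…` repeats the summit name by design (D-0017)
set_option linter.dupNamespace false

open scoped Classical NumberField ContRepresentation TensorProduct Pointwise
open Field ValuativeRel NumberField IsDedekindDomain
open WeierstrassCurve Literature.NumberTheory.EllipticCurves Literature.NumberTheory.GaloisRepresentations
  Literature.NumberTheory.GaloisRepresentations.DiscreteGaloisModule
  Literature.NumberTheory.EllipticCurves.Kato2004.EulerSystemValues
open Literature.NumberTheory.GaloisRepresentations.PeriodRingData Literature.NumberTheory.PAdicHodge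
open Literature.NumberTheory.AdelicBaseChange Literature.NumberTheory.Automorphic
open Summit.BirchSwinnertonDyer.Rank1Residual.GaloisImage
open Summit.BirchSwinnertonDyer.BirchSwinnertonDyer.Theorems.KimAtThreeDeepLowerExpStarOmega
open Summit.BirchSwinnertonDyer.BirchSwinnertonDyer.Theorems.KimAtThreeDeepLowerExpStarOmegaPlace
open Summit.BirchSwinnertonDyer.BirchSwinnertonDyer.Theorems.KimAtThreeFineKatoDefinedLambda

namespace Summit.BirchSwinnertonDyer.BirchSwinnertonDyer.Theorems.KimAtThreeFineKatoDefinedLambdaValues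

variable (W : WeierstrassCurve ℚ) [W.IsElliptic] (p : ℕ) [hp : Fact p.Prime]
  [ContinuousSMul ℤ_[p] (W.tateModule p)] (k : ℕ) (r : Finset (HeightOneSpectrum (𝓞 ℚ)))
  (Ψ : ℚ_[p] ⊗[ℚ] CyclotomicField (cycLevel p k r) ℚ ≃ₐ[ℚ]
    (Π w : ((Rat.HeightOneSpectrum.primesEquiv (R := 𝓞 ℚ)).symm ⟨p, Fact.out⟩).Extension (𝓞 (CyclotomicField (cycLevel p k r) ℚ)), w.1.adicCompletion (CyclotomicField (cycLevel p k r) ℚ)))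
  (hΨ : ∀ (s : ℚ_[p]) (x : CyclotomicField (cycLevel p k r) ℚ) (w : ((Rat.HeightOneSpectrum.primesEquiv (R := 𝓞 ℚ)).symm ⟨p, Fact.out⟩).Extension (𝓞 (CyclotomicField (cycLevel p k r) ℚ))),
    Ψ (s ⊗ₜ[ℚ] x) w = algebraMap (CyclotomicField (cycLevel p k r) ℚ) (w.1.adicCompletion (CyclotomicField (cycLevel p k r) ℚ)) x *
      algebraMap (((Rat.HeightOneSpectrum.primesEquiv (R := 𝓞 ℚ)).symm ⟨p, Fact.out⟩).adicCompletion ℚ) (w.1.adicCompletion (CyclotomicField (cycLevel p k r) ℚ)) (Padic.adicCompletionEquiv (𝓞 ℚ) ⟨p, Fact.out⟩ s))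
  (w₀ : ((Rat.HeightOneSpectrum.primesEquiv (R := 𝓞 ℚ)).symm ⟨p, Fact.out⟩).Extension (𝓞 (CyclotomicField (cycLevel p k r) ℚ)))
  (hw₀ : ((p : ℕ) : 𝓞 (CyclotomicField (cycLevel p k r) ℚ)) ∈ w₀.1.asIdeal)
  (g : ((Rat.HeightOneSpectrum.primesEquiv (R := 𝓞 ℚ)).symm ⟨p, Fact.out⟩).Extension (𝓞 (CyclotomicField (cycLevel p k r) ℚ)) → absoluteGaloisGroup ℚ)
  (hg : ∀ w : ((Rat.HeightOneSpectrum.primesEquiv (R := 𝓞 ℚ)).symm ⟨p, Fact.out⟩).Extension (𝓞 (CyclotomicField (cycLevel p k r) ℚ)), sigma (cycLevel p k r) (modNCyclotomicCharacter ℚ (cycLevel p k r) (g w)) • w.1 = w₀.1)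

omit [W.IsElliptic] [ContinuousSMul ℤ_[p] (W.tateModule p)] in
include hΨ in
/-- `Ψ (1 ⊗ x)_w = ι_w(x)` (the pure-tensor formula at `s = 1`). [cite: CasselsFrohlichANT1967, Ch. II §10 Theorem (10.2)] -/
theorem apply_one_tmul (x : CyclotomicField (cycLevel p k r) ℚ) (w : ((Rat.HeightOneSpectrum.primesEquiv (R := 𝓞 ℚ)).symm ⟨p, Fact.out⟩).Extension (𝓞 (CyclotomicField (cycLevel p k r) ℚ))) :
    Ψ ((1 : ℚ_[p]) ⊗ₜ[ℚ] x) w = algebraMap (CyclotomicField (cycLevel p k r) ℚ) (w.1.adicCompletion (CyclotomicField (cycLevel p k r) ℚ)) x := by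
  rw [hΨ, map_one, map_one, mul_one]

set_option backward.isDefEq.respectTransparency false in
/-- **(C4) for `katoLambda`, read without `Ψ`** (module docstring): `katoLambda … z = 1 ⊗ₜ x` iff for every `w ∣ p`
the value of the defined `exp*_{w₀} ∘ loc^{tower}_{w₀}` on the twisted class `g_w · z` is the `w₀`-adic image of the conjugate
`g̃_w x` (`g̃_w = sigma m (χ_m (g w))`). [cite: Kato2004Asterisque, §9.4 and Thm. 9.7 (p. 189)]
[cite: CasselsFrohlichANT1967, Ch. II §10 Theorem (10.2) and Ch. VII §1.1] -/
theorem katoLambda_eq_one_tmul_iff :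
    letI := LocalField.charZero_adicCompletion w₀.1
    letI := LocalField.adicCompletionPadicAlgebra w₀.1 p hw₀
    haveI : Fact (¬ IsUnit ((p : ℕ) : integerC (w₀.1.adicCompletion (CyclotomicField (cycLevel p k r) ℚ)))) := ⟨not_isUnit_natCast_integerC (LocalField.valuation_adicCompletion_natCast_lt_one w₀.1 p hw₀)⟩
    haveI := isAdicComplete_integerC_natCast (LocalField.valuation_adicCompletion_natCast_lt_one w₀.1 p hw₀)
    ∀ (dw : LocalNeronLine W (LocalField.valuation_adicCompletion_natCast_lt_one w₀.1 p hw₀) ((galRestrictPlace ((Rat.HeightOneSpectrum.primesEquiv (R := 𝓞 ℚ)).symm ⟨p, Fact.out⟩)).comp (absGaloisRestrict (((Rat.HeightOneSpectrum.primesEquiv (R := 𝓞 ℚ)).symm ⟨p, Fact.out⟩).adicCompletion ℚ) (w₀.1.adicCompletion (CyclotomicField (cycLevel p k r) ℚ)))))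
      (hinjw : (bdRPeriodRingData (LocalField.valuation_adicCompletion_natCast_lt_one w₀.1 p hw₀)).CupLogInjective (logCyclotomic p) (localRationalTateRep W p ((galRestrictPlace ((Rat.HeightOneSpectrum.primesEquiv (R := 𝓞 ℚ)).symm ⟨p, Fact.out⟩)).comp (absGaloisRestrict (((Rat.HeightOneSpectrum.primesEquiv (R := 𝓞 ℚ)).symm ⟨p, Fact.out⟩).adicCompletion ℚ) (w₀.1.adicCompletion (CyclotomicField (cycLevel p k r) ℚ))))))
      (hexw : ∀ z : contOneCocycles (localRationalTateRep W p ((galRestrictPlace ((Rat.HeightOneSpectrum.primesEquiv (R := 𝓞 ℚ)).symm ⟨p, Fact.out⟩)).comp (absGaloisRestrict (((Rat.HeightOneSpectrum.primesEquiv (R := 𝓞 ℚ)).symm ⟨p, Fact.out⟩).adicCompletion ℚ) (w₀.1.adicCompletion (CyclotomicField (cycLevel p k r) ℚ))))).toTopRep,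
        (bdRPeriodRingData (LocalField.valuation_adicCompletion_natCast_lt_one w₀.1 p hw₀)).HasDualExp (logCyclotomic p) (localRationalTateRep W p ((galRestrictPlace ((Rat.HeightOneSpectrum.primesEquiv (R := 𝓞 ℚ)).symm ⟨p, Fact.out⟩)).comp (absGaloisRestrict (((Rat.HeightOneSpectrum.primesEquiv (R := 𝓞 ℚ)).symm ⟨p, Fact.out⟩).adicCompletion ℚ) (w₀.1.adicCompletion (CyclotomicField (cycLevel p k r) ℚ))))) fun σ => z.1 σ)
      (z : H1 (tateRep W p) (cycSubgroup p k r)) (x : CyclotomicField (cycLevel p k r) ℚ),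
      katoLambda W p k r w₀ Ψ hΨ hw₀ g hg dw hinjw hexw z = (1 : ℚ_[p]) ⊗ₜ[ℚ] x ↔
        ∀ w : ((Rat.HeightOneSpectrum.primesEquiv (R := 𝓞 ℚ)).symm ⟨p, Fact.out⟩).Extension (𝓞 (CyclotomicField (cycLevel p k r) ℚ)),
          expStarTowerMap W p k r w₀ hw₀ dw hinjw hexw (conjMap (tateRep W p).toTopRep (cycSubgroup p k r) (g w) 1 z) =
            algebraMap (CyclotomicField (cycLevel p k r) ℚ) (w₀.1.adicCompletion (CyclotomicField (cycLevel p k r) ℚ)) (sigma (cycLevel p k r) (modNCyclotomicCharacter ℚ (cycLevel p k r) (g w)) x) := by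
  intro dw hinjw hexw z x
  constructor
  · intro hz w
    have hw := apply_katoLambda W p k r w₀ Ψ hΨ hw₀ g hg dw hinjw hexw z w
    rw [hz, apply_one_tmul p k r Ψ hΨ x w] at hw
    -- apply `(g̃_w)_*` to `(g̃_w⁻¹)_* (F (g_w · z)) = ι_w x`
    have hw' := congrArg (galAdicCompletionMap (sigma (cycLevel p k r) (modNCyclotomicCharacter ℚ (cycLevel p k r) (g w))) (hg w)) hw
    rw [galAdicCompletionMap_apply_inv] at hw'
    rw [← hw']
    exact galAdicCompletionMap_coe_algEquiv ℚ _ (hg w) x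
  · intro h
    apply Ψ.injective
    funext w
    rw [apply_katoLambda, apply_one_tmul p k r Ψ hΨ x w, h w]
    have hc := galAdicCompletionMap_coe_algEquiv ℚ
      (sigma (cycLevel p k r) (modNCyclotomicCharacter ℚ (cycLevel p k r) (g w)))⁻¹ (inv_smul_eq_of_smul_eq (hg w))
      (sigma (cycLevel p k r) (modNCyclotomicCharacter ℚ (cycLevel p k r) (g w)) x)
    rw [← AlgEquiv.mul_apply, inv_mul_cancel, AlgEquiv.one_apply] at hc
    exact hc

/-- **The reading at the base place `w₀` itself**: (C4) for `katoLambda` gives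
`exp*_{w₀}(loc_{w₀}(g_{w₀} · z)) = ι_{w₀}(g̃_{w₀} x)` (the `w = w₀` instance of `katoLambda_eq_one_tmul_iff`).
[cite: Kato2004Asterisque, Thm. 9.7 (p. 189)] -/
theorem expStarTowerMap_conjMap_eq_of_katoLambda_eq_one_tmul :
    letI := LocalField.charZero_adicCompletion w₀.1
    letI := LocalField.adicCompletionPadicAlgebra w₀.1 p hw₀
    haveI : Fact (¬ IsUnit ((p : ℕ) : integerC (w₀.1.adicCompletion (CyclotomicField (cycLevel p k r) ℚ)))) := ⟨not_isUnit_natCast_integerC (LocalField.valuation_adicCompletion_natCast_lt_one w₀.1 p hw₀)⟩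
    haveI := isAdicComplete_integerC_natCast (LocalField.valuation_adicCompletion_natCast_lt_one w₀.1 p hw₀)
    ∀ (dw : LocalNeronLine W (LocalField.valuation_adicCompletion_natCast_lt_one w₀.1 p hw₀) ((galRestrictPlace ((Rat.HeightOneSpectrum.primesEquiv (R := 𝓞 ℚ)).symm ⟨p, Fact.out⟩)).comp (absGaloisRestrict (((Rat.HeightOneSpectrum.primesEquiv (R := 𝓞 ℚ)).symm ⟨p, Fact.out⟩).adicCompletion ℚ) (w₀.1.adicCompletion (CyclotomicField (cycLevel p k r) ℚ)))))
      (hinjw : (bdRPeriodRingData (LocalField.valuation_adicCompletion_natCast_lt_one w₀.1 p hw₀)).CupLogInjective (logCyclotomic p) (localRationalTateRep W p ((galRestrictPlace ((Rat.HeightOneSpectrum.primesEquiv (R := 𝓞 ℚ)).symm ⟨p, Fact.out⟩)).comp (absGaloisRestrict (((Rat.HeightOneSpectrum.primesEquiv (R := 𝓞 ℚ)).symm ⟨p, Fact.out⟩).adicCompletion ℚ) (w₀.1.adicCompletion (CyclotomicField (cycLevel p k r) ℚ))))))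
      (hexw : ∀ z : contOneCocycles (localRationalTateRep W p ((galRestrictPlace ((Rat.HeightOneSpectrum.primesEquiv (R := 𝓞 ℚ)).symm ⟨p, Fact.out⟩)).comp (absGaloisRestrict (((Rat.HeightOneSpectrum.primesEquiv (R := 𝓞 ℚ)).symm ⟨p, Fact.out⟩).adicCompletion ℚ) (w₀.1.adicCompletion (CyclotomicField (cycLevel p k r) ℚ))))).toTopRep,
        (bdRPeriodRingData (LocalField.valuation_adicCompletion_natCast_lt_one w₀.1 p hw₀)).HasDualExp (logCyclotomic p) (localRationalTateRep W p ((galRestrictPlace ((Rat.HeightOneSpectrum.primesEquiv (R := 𝓞 ℚ)).symm ⟨p, Fact.out⟩)).comp (absGaloisRestrict (((Rat.HeightOneSpectrum.primesEquiv (R := 𝓞 ℚ)).symm ⟨p, Fact.out⟩).adicCompletion ℚ) (w₀.1.adicCompletion (CyclotomicField (cycLevel p k r) ℚ))))) fun σ => z.1 σ)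
      (z : H1 (tateRep W p) (cycSubgroup p k r)) (x : CyclotomicField (cycLevel p k r) ℚ),
      katoLambda W p k r w₀ Ψ hΨ hw₀ g hg dw hinjw hexw z = (1 : ℚ_[p]) ⊗ₜ[ℚ] x →
        expStarTowerMap W p k r w₀ hw₀ dw hinjw hexw (conjMap (tateRep W p).toTopRep (cycSubgroup p k r) (g w₀) 1 z) =
          algebraMap (CyclotomicField (cycLevel p k r) ℚ) (w₀.1.adicCompletion (CyclotomicField (cycLevel p k r) ℚ)) (sigma (cycLevel p k r) (modNCyclotomicCharacter ℚ (cycLevel p k r) (g w₀)) x) :=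
  fun dw hinjw hexw z x hz => (katoLambda_eq_one_tmul_iff W p k r Ψ hΨ w₀ hw₀ g hg dw hinjw hexw z x).1 hz w₀

end Summit.BirchSwinnertonDyer.BirchSwinnertonDyer.Theorems.KimAtThreeFineKatoDefinedLambdaValues

end
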